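import Literature.Geometry.Lorentzian.BoostedKerrCausalLegs
import Literature.Geometry.Lorentzian.KerrRadiusGradientVector
import Literature.Geometry.Lorentzian.MultiCentreRadiationZone
import Literature.Geometry.Lorentzian.CausalFutureProofs
import Literature.Geometry.Lorentzian.CausalityConditionsProofs
import HarnessLib

/-!
# Rest-frame Kerr–Schild kinematics on the horizon collar (the `KerrPeel` toolbox)

Elementary, fully proved facts about the Kerr–Schild form `g_{M,a} = η + 2H ℓ ⊗ ℓ` on `E4`
(`Kerr.bilin`, `Kerr.timeVector` `V = −g♯dt*`, `Kerr.radiusGradVector`, `Kerr.radius`) that the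
two-sided horizon-collar arguments over a boosted Kerr–Schild model background use, for ALL `M > 0`
and all `a` (sub-extremality is not needed anywhere in this file):

* §1 rest-frame facts: `M ≤ r₊`, `Σ ≤ 2r² + a²`, the red-shift lower bound
  `2H ≥ 2 M r₁ / (2 r₂² + a²)` on a shell `r₁ ≤ r ≤ r₂` (Visser, (33)), `g(V,V) ≤ −1`, `V⁰ ≥ 1`,
  `dr(V) = −2H` (Visser, (32)–(35)); the time normalisation `tn x = (0, x⃗)` (all Kerr–Schild data
  are `t*`-independent: `bilin_tn`, `timeVector_tn`, `radiusGradVector_tn`, …); continuity of the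
  data wherever `r > 0`; the compact time-normalised shells `shell a r₁ r₂ = {x⁰ = 0, r₁ ≤ r ≤ r₂}`
  and `shell'`; operator-norm control of values of (bi)linear forms.
* §2 uniform constants and moduli on a shell `0 < r₁ ≤ r ≤ r₂`: `bound_package` (`‖V‖ ≤ C_V`,
  `‖dr‖ ≤ C_W`), `modulus_package` (Heine–Cantor on the thickened shell), the one-sided mean value
  bounds for the radius along a rest-frame segment (`radius_segment_mvt`).
* the boost bookkeeping `boostedKerrBilin_apply_boost` (`g_{Λ,c}(x)(Λv, Λw) = g_{M,a}(Λ⁻¹(x−c))(v,w)`),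
  `poincareInv_add_smul`; the coercivity `g_{M,a}(v,v) ≥ ‖v‖² − 2(v⁰)²` (`kerr_self_ge`,
  `minkowski_self_eq`), `abs_apply₂_le`.
* §3 (section `Chart`, for any time-oriented `Spacetime 4` and any chart `Φ` of a `ModelBackground`):
  metric values of pushed-forward vectors under a deviation bound (`val_mfderiv_le`,
  `val_mfderiv_le_of_sub`), `J⁺ ∘ J⁺ = J⁺` (`mem_causalFuture_trans'`), pointwise `C⁰`/`C¹` bounds
  from the `C¹` slab bound (`dev_bounds`, Bartnik 1986 (1.3) weighted-norm bookkeeping), and the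
  `ε`-Lipschitz bound of the deviation along chart segments (`deviation_segment_lipschitz`, mean value
  inequality).

These are the shared helper blocks of the collar climb (`KerrPeelClimb`), the horizon leaf anchor
(`KerrAnchor`) and the collar slope field (`KerrSlope`).  Everything here is classical: O'Neill 1983,
Ch. 5 (Lemmas 5.26, 5.29) and Ch. 14 (p. 402); Kerr–Schild 1965 (Lorentz covariance of the form);
Visser arXiv:0706.0622, (32)–(35); Dafermos–Rodnianski arXiv:0811.0354, §5.1 (time-normalised shells).
Provenance: the engine namespace `KerrPeel` of the decomp-fsc lens-3 side files (g32
`HorizonPeeling32.lean` ll. 172–666, g33 `HorizonLeafAnchor33.lean` ll. 347–366), re-homed verbatim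
up to line wrapping and linter hygiene; no statement was changed.

NOT here: the collar climb itself (`KerrPeelClimb`), anything about Cauchy developments or the
final state conjecture (route side), sub-extremal red-shift algebra (`KerrSlope`).
-/

noncomputable section

open scoped Topology Manifold ContDiff ENNReal
open Filter Set Function

namespace Literature.Geometry.Lorentzian

namespace KerrPeel

open Metric

-- typeclass search through nested operator types `E4 →L[ℝ] E4 →L[ℝ] ℝ` (as in `BoostedKerrCausalLegs`)
set_option maxSynthPendingDepth 3

variable {M a : ℝ} {x : E4}

/-! ### §1 Rest-frame facts -/

/-- `M ≤ r₊`. [cite: ONeill1995, §2.5] -/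
theorem le_rPlus (M a : ℝ) : M ≤ Kerr.rPlus M a :=
  le_add_of_nonneg_right (Real.sqrt_nonneg _)

/-- `Σ ≤ 2r² + a²` (`Σ = 2r² − |x⃗|² + a²`). [cite: DafermosRodnianskiShlapentokhrothman2014, §2.1.1] -/
theorem blSigma_spatial_le (a : ℝ) (x : E4) :
    Kerr.blSigma a (E4.spatial x) ≤ 2 * Kerr.radius a x ^ 2 + a ^ 2 := by
  unfold Kerr.blSigma
  rw [Kerr.radius_ofTimeSpace_spatial]
  nlinarith [sq_nonneg ‖E4.spatial x‖]

/-- **`2H ≥ 2 M r₁ / (2 r₂² + a²)` on `r₁ ≤ r ≤ r₂`** (`H = M r³/(r⁴ + a² z²)`, `r⁴ + a² z² = r² Σ ≤ r²(2r² + a²)`).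
Visser arXiv:0706.0622, (33). [cite: arXiv07060622, (33)] -/
theorem two_mul_scalarH_ge (hM : 0 < M) {r₁ r₂ : ℝ} (hr₁ : 0 < r₁) (h₁ : r₁ ≤ Kerr.radius a x)
    (h₂ : Kerr.radius a x ≤ r₂) : 2 * M * r₁ / (2 * r₂ ^ 2 + a ^ 2) ≤ 2 * Kerr.scalarH M a x := by
  have hr0 : 0 < Kerr.radius a x := lt_of_lt_of_le hr₁ h₁
  have hS0 : 0 < Kerr.blSigma a (E4.spatial x) := Kerr.blSigma_spatial_pos hr0
  have hSle : Kerr.blSigma a (E4.spatial x) ≤ 2 * r₂ ^ 2 + a ^ 2 := by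
    have h := blSigma_spatial_le a x
    have : Kerr.radius a x ^ 2 ≤ r₂ ^ 2 := pow_le_pow_left₀ hr0.le h₂ 2
    linarith
  have hr2 : 0 < 2 * r₂ ^ 2 + a ^ 2 := lt_of_lt_of_le hS0 hSle
  rw [Kerr.scalarH_eq_div_blSigma M a hr0, div_le_iff₀ hr2]
  have h3 : r₁ ≤ Kerr.radius a x / Kerr.blSigma a (E4.spatial x) * (2 * r₂ ^ 2 + a ^ 2) := by
    rw [div_mul_eq_mul_div, le_div_iff₀ hS0]
    calc r₁ * Kerr.blSigma a (E4.spatial x) ≤ Kerr.radius a x * (2 * r₂ ^ 2 + a ^ 2) :=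
          mul_le_mul h₁ hSle hS0.le hr0.le
      _ = Kerr.radius a x * (2 * r₂ ^ 2 + a ^ 2) := rfl
  have h4 : 2 * M * r₁ ≤ 2 * M * (Kerr.radius a x / Kerr.blSigma a (E4.spatial x) * (2 * r₂ ^ 2 + a ^ 2)) :=
    mul_le_mul_of_nonneg_left h3 (by positivity)
  calc 2 * M * r₁ ≤ 2 * M * (Kerr.radius a x / Kerr.blSigma a (E4.spatial x) * (2 * r₂ ^ 2 + a ^ 2)) := h4
    _ = 2 * (M * Kerr.radius a x / Kerr.blSigma a (E4.spatial x)) * (2 * r₂ ^ 2 + a ^ 2) := by ring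

/-- `g(V, V) = −1 − 2H ≤ −1` and `V⁰ = 1 + 2H ≥ 1`, `dr(V) = −2H` wherever `r > 0` (`M ≥ 0`).
Visser arXiv:0706.0622, (32)–(35). [cite: arXiv07060622, (32)–(35)] -/
theorem timeVector_facts (hM : 0 ≤ M) (hx : 0 < Kerr.radius a x) :
    Kerr.bilin M a x (Kerr.timeVector M a x) (Kerr.timeVector M a x) ≤ -1 ∧
    1 ≤ Kerr.timeVector M a x 0 ∧
    Kerr.bilin M a x (Kerr.radiusGradVector M a x) (Kerr.timeVector M a x) = -(2 * Kerr.scalarH M a x) := by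
  have hH := Kerr.scalarH_nonneg hM a x
  refine ⟨?_, ?_, ?_⟩
  · rw [Kerr.bilin_timeVector_timeVector hx]; linarith
  · have h := Kerr.bilin_timeVector (M := M) hx (Kerr.timeVector M a x)
    rw [Kerr.bilin_timeVector_timeVector hx] at h
    have h' : Kerr.timeVector M a x 0 = 1 + 2 * Kerr.scalarH M a x := by
      have : (Kerr.timeVector M a x).ofLp 0 = Kerr.timeVector M a x 0 := rfl
      linarith
    linarith
  · rw [Kerr.bilin_symm, Kerr.bilin_timeVector_radiusGradVector hx]

/-! #### Time normalisation `x ↦ (0, x⃗)` (the Kerr–Schild data are `t*`-independent) -/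

/-- The time-normalised point `(0, x⃗)`. [cite: arXiv07060622, (32)–(35)] -/
def tn (x : E4) : E4 := E4.ofTimeSpace 0 (E4.spatial x)

/-- `(tn x)⁰ = 0`. [cite: arXiv07060622, (32)–(35)] -/
theorem tn_apply_zero (x : E4) : tn x 0 = 0 := E4.ofTimeSpace_apply_zero 0 _

/-- `tn` keeps the spatial components: `(tn x)^{i+1} = x^{i+1}`. [cite: arXiv07060622, (32)–(35)] -/
theorem tn_apply_succ (x : E4) (i : Fin 3) : tn x i.succ = x i.succ :=
  E4.ofTimeSpace_apply_succ 0 (E4.spatial x) i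

/-- `(tn x)¹ = x¹`. [cite: arXiv07060622, (32)–(35)] -/
theorem tn_apply_one (x : E4) : tn x 1 = x 1 := tn_apply_succ x 0
/-- `(tn x)² = x²`. [cite: arXiv07060622, (32)–(35)] -/
theorem tn_apply_two (x : E4) : tn x 2 = x 2 := tn_apply_succ x 1
/-- `(tn x)³ = x³`. [cite: arXiv07060622, (32)–(35)] -/
theorem tn_apply_three (x : E4) : tn x 3 = x 3 := tn_apply_succ x 2

/-- The spatial part of `tn x` is that of `x`. [cite: arXiv07060622, (32)–(35)] -/
@[simp] theorem spatial_tn (x : E4) : E4.spatial (tn x) = E4.spatial x := E4.spatial_ofTimeSpace 0 _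

/-- `tn x = x − x⁰ e₀`. [cite: arXiv07060622, (32)–(35)] -/
theorem tn_eq (x : E4) : tn x = x - (x 0) • E4.basisVector 0 := by
  ext i
  refine Fin.cases ?_ (fun j => ?_) i
  · simp [tn_apply_zero]
  · rw [tn_apply_succ]
    simp [Fin.succ_ne_zero]

/-- `tn` is affine along segments: `tn (x + θ v) = tn x + θ tn v`. [cite: arXiv07060622, (32)–(35)] -/
theorem tn_add_smul (x v : E4) (θ : ℝ) : tn (x + θ • v) = tn x + θ • tn v := by
  rw [tn_eq, tn_eq, tn_eq]
  simp only [PiLp.add_apply, PiLp.smul_apply, smul_eq_mul]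
  module

/-- `tn x − tn y = tn (x − y)`. [cite: arXiv07060622, (32)–(35)] -/
theorem tn_sub (x y : E4) : tn x - tn y = tn (x - y) := by
  rw [tn_eq, tn_eq, tn_eq]
  simp only [PiLp.sub_apply]
  module

/-- `‖x‖² = (x⁰)² + (x¹)² + (x²)² + (x³)²`. (Euclidean coordinate bookkeeping in the Kerr–Schild Cartesian chart `(t*, x, y, z)`, Visser (32)) [cite: arXiv07060622, (32)–(35)] -/
theorem norm_sq_E4 (v : E4) : ‖v‖ ^ 2 = v 0 ^ 2 + v 1 ^ 2 + v 2 ^ 2 + v 3 ^ 2 := by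
  rw [EuclideanSpace.real_norm_sq_eq]
  simp [Fin.sum_univ_four]

/-- A coordinate is bounded by the Euclidean norm: `|v^μ| ≤ ‖v‖`. (Kerr–Schild Cartesian chart, Visser (32)) [cite: arXiv07060622, (32)–(35)] -/
theorem abs_apply_le_norm (v : E4) (μ : Fin 4) : |v μ| ≤ ‖v‖ := by
  have h := PiLp.norm_apply_le v μ
  rwa [Real.norm_eq_abs] at h

/-- Time normalisation does not increase the Euclidean norm: `‖tn v‖ ≤ ‖v‖`. [cite: arXiv07060622, (32)–(35)] -/
theorem norm_tn_le (v : E4) : ‖tn v‖ ≤ ‖v‖ := by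
  have h1 := norm_sq_E4 (tn v)
  have h2 := norm_sq_E4 v
  rw [tn_apply_zero, tn_apply_one, tn_apply_two, tn_apply_three] at h1
  have h : ‖tn v‖ ^ 2 ≤ ‖v‖ ^ 2 := by nlinarith [sq_nonneg (v 0)]
  exact (pow_le_pow_iff_left₀ (norm_nonneg _) (norm_nonneg _) two_ne_zero).1 h

/-- `‖x‖² ≤ (x⁰)² + r² + a²` (`|x⃗|² − a² ≤ r²`). [cite: arXiv07060622, (35)] -/
theorem norm_sq_le (a : ℝ) (x : E4) : ‖x‖ ^ 2 ≤ x 0 ^ 2 + Kerr.radius a x ^ 2 + a ^ 2 := by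
  have h1 := norm_sq_E4 x
  have h2 := E4.spatialNorm_sq x
  have h3 := Kerr.spatialNorm_sq_sub_sq_le_radius_sq a x
  linarith

/-- The Kerr–Schild radius is `t*`-independent: `r(tn x) = r(x)`. [cite: KerrSchild1965] -/
theorem radius_tn (a : ℝ) (x : E4) : Kerr.radius a (tn x) = Kerr.radius a x :=
  Kerr.radius_ofTimeSpace_spatial a x

/-- `H` is `t*`-independent: `H(tn x) = H(x)`. [cite: KerrSchild1965] -/
theorem scalarH_tn (M a : ℝ) (x : E4) : Kerr.scalarH M a (tn x) = Kerr.scalarH M a x := by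
  unfold Kerr.scalarH
  rw [radius_tn, tn_apply_three]

/-- The components of `ℓ` are `t*`-independent. [cite: KerrSchild1965] -/
theorem nullCovectorFun_tn (a : ℝ) (x : E4) : Kerr.nullCovectorFun a (tn x) = Kerr.nullCovectorFun a x := by
  unfold Kerr.nullCovectorFun
  rw [radius_tn, tn_apply_one, tn_apply_two, tn_apply_three]

/-- `ℓ` is `t*`-independent: `ℓ(tn x) = ℓ(x)`. [cite: KerrSchild1965] -/
theorem nullCovector_tn (a : ℝ) (x : E4) : Kerr.nullCovector a (tn x) = Kerr.nullCovector a x := by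
  unfold Kerr.nullCovector
  rw [nullCovectorFun_tn]

/-- `ℓ♯` is `t*`-independent. [cite: KerrSchild1965] -/
theorem nullVector_tn (a : ℝ) (x : E4) : Kerr.nullVector a (tn x) = Kerr.nullVector a x := by
  unfold Kerr.nullVector
  rw [nullCovectorFun_tn]

/-- The Kerr–Schild form is `t*`-independent: `g(tn x) = g(x)`. [cite: KerrSchild1965] -/
theorem bilin_tn (M a : ℝ) (x : E4) : Kerr.bilin M a (tn x) = Kerr.bilin M a x := by
  unfold Kerr.bilin
  rw [scalarH_tn, nullCovector_tn]

/-- `V = −g♯dt*` is `t*`-independent: `V(tn x) = V(x)`. [cite: KerrSchild1965] -/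
theorem timeVector_tn (M a : ℝ) (x : E4) : Kerr.timeVector M a (tn x) = Kerr.timeVector M a x := by
  unfold Kerr.timeVector
  rw [scalarH_tn, nullVector_tn]

/-- The radius gradient vector is `t*`-independent: `W(tn x) = W(x)`. [cite: KerrSchild1965] -/
theorem radiusGradVector_tn (M a : ℝ) (x : E4) :
    Kerr.radiusGradVector M a (tn x) = Kerr.radiusGradVector M a x := by
  unfold Kerr.radiusGradVector
  rw [spatial_tn, scalarH_tn, nullVector_tn]

/-! #### Continuity of the Kerr–Schild data wherever `r > 0` -/

/-- `x ↦ g_x` is continuous wherever `r > 0`. [cite: KerrSchild1965] -/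
theorem continuousAt_bilin (M a : ℝ) (hx : 0 < Kerr.radius a x) :
    ContinuousAt (Kerr.bilin M a) x :=
  (Kerr.contDiffAt_bilin M a hx (n := 0)).continuousAt

/-- `x ↦ V_x` is continuous wherever `r > 0`. [cite: KerrSchild1965] -/
theorem continuousAt_timeVector (M a : ℝ) (hx : 0 < Kerr.radius a x) :
    ContinuousAt (Kerr.timeVector M a) x :=
  (Kerr.contDiffAt_timeVector M a hx (n := 0)).continuousAt

/-- `x ↦ r(0, x⃗)` is continuous. [cite: KerrSchild1965] -/
theorem continuous_radius_slice_spatial (a : ℝ) :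
    Continuous fun x : E4 => Kerr.radius a (E4.ofTimeSpace 0 (E4.spatial x)) :=
  (Kerr.continuous_radius a).comp ((E4.continuous_ofTimeSpace 0).comp E4.spatial.continuous)

/-- `x ↦ Σ(x⃗)` is continuous. [cite: KerrSchild1965] -/
theorem continuous_blSigma_spatial (a : ℝ) :
    Continuous fun x : E4 => Kerr.blSigma a (E4.spatial x) := by
  unfold Kerr.blSigma
  exact ((continuous_const.mul ((continuous_radius_slice_spatial a).pow 2)).sub
    ((E4.spatial.continuous.norm).pow 2)).add continuous_const

/-- `x ↦ ∇r(x⃗)` (the spatial radius gradient) is continuous wherever `r > 0`. [cite: KerrSchild1965] -/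
theorem continuousAt_radiusGradVec_spatial (a : ℝ) (hx : 0 < Kerr.radius a x) :
    ContinuousAt (fun x : E4 => Kerr.radiusGradVec a (E4.spatial x)) x := by
  unfold Kerr.radiusGradVec
  have hr : Kerr.radius a (E4.ofTimeSpace 0 (E4.spatial x)) = Kerr.radius a x :=
    Kerr.radius_ofTimeSpace_spatial a x
  have hne : Kerr.radius a (E4.ofTimeSpace 0 (E4.spatial x)) * Kerr.blSigma a (E4.spatial x) ≠ 0 := by
    rw [hr]
    exact mul_ne_zero hx.ne' (Kerr.blSigma_spatial_pos hx).ne'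
  have h1 : ContinuousAt (fun x : E4 => (Kerr.radius a (E4.ofTimeSpace 0 (E4.spatial x)) *
      Kerr.blSigma a (E4.spatial x))⁻¹) x :=
    (((continuous_radius_slice_spatial a).mul (continuous_blSigma_spatial a)).continuousAt).inv₀ hne
  have h2 : Continuous fun x : E4 => Kerr.radius a (E4.ofTimeSpace 0 (E4.spatial x)) ^ 2 • E4.spatial x +
      (a ^ 2 * E4.spatial x 2) • (EuclideanSpace.single 2 1 : E3) := by
    have h3 : Continuous fun x : E4 => a ^ 2 * E4.spatial x 2 :=
      continuous_const.mul ((EuclideanSpace.proj (2 : Fin 3)).continuous.comp E4.spatial.continuous)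
    exact (((continuous_radius_slice_spatial a).pow 2).smul E4.spatial.continuous).add
      (h3.smul continuous_const)
  exact h1.smul h2.continuousAt

/-- `x ↦ W_x` (the radius gradient vector) is continuous wherever `r > 0`. [cite: KerrSchild1965] -/
theorem continuousAt_radiusGradVector (M a : ℝ) (hx : 0 < Kerr.radius a x) :
    ContinuousAt (Kerr.radiusGradVector M a) x := by
  unfold Kerr.radiusGradVector
  refine ((E4.continuous_ofTimeSpace 0).continuousAt.comp (continuousAt_radiusGradVec_spatial a hx)).sub ?_
  exact (continuousAt_const.mul (Kerr.contDiffAt_scalarH M a hx (n := 0)).continuousAt).smul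
    (Kerr.contDiffAt_nullVector a hx (n := 0)).continuousAt

/-- Continuity of the radius differential `x ↦ dr_x = g_x(W, ·)`. [cite: ONeill1995, §2.5] -/
theorem continuousAt_radiusDeriv (M a : ℝ) (hx : 0 < Kerr.radius a x) :
    ContinuousAt (fun x : E4 => Kerr.bilin M a x (Kerr.radiusGradVector M a x)) x :=
  (continuousAt_bilin M a hx).clm_apply (continuousAt_radiusGradVector M a hx)

/-! #### The compact shells -/

/-- The time-normalised closed shell `K = {x⁰ = 0, r₁ ≤ r ≤ r₂}`. [cite: arXiv07060622, (35)] -/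
def shell (a r₁ r₂ : ℝ) : Set E4 :=
  {x | x 0 = 0 ∧ r₁ ≤ Kerr.radius a x ∧ Kerr.radius a x ≤ r₂}

/-- The time coordinate `x ↦ x⁰` is continuous on `E4`. (Kerr–Schild Cartesian chart, Visser (32)) [cite: arXiv07060622, (32)–(35)] -/
theorem continuous_apply_zero_E4 : Continuous fun x : E4 => x 0 :=
  (EuclideanSpace.proj (0 : Fin 4)).continuous

/-- The time-normalised shell is closed. [cite: arXiv07060622, (35)] -/
theorem isClosed_shell (a r₁ r₂ : ℝ) : IsClosed (shell a r₁ r₂) :=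
  (isClosed_eq continuous_apply_zero_E4 continuous_const).inter
    ((isClosed_le continuous_const (Kerr.continuous_radius a)).inter
      (isClosed_le (Kerr.continuous_radius a) continuous_const))

/-- Points of the shell have norm `≤ r₂ + |a|` (`|x⃗|² ≤ r² + a²`). [cite: arXiv07060622, (35)] -/
theorem norm_le_of_mem_shell {r₁ r₂ : ℝ} (hr₂ : 0 ≤ r₂) (hx : x ∈ shell a r₁ r₂) :
    ‖x‖ ≤ r₂ + |a| := by
  have h := norm_sq_le a x
  rw [hx.1] at h
  have hr0 := Kerr.radius_nonneg a x
  have h2' : Kerr.radius a x ^ 2 ≤ r₂ ^ 2 := pow_le_pow_left₀ hr0 hx.2.2 2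
  have ha := abs_nonneg a
  have ha2 : a ^ 2 = |a| ^ 2 := (sq_abs a).symm
  have h2 : ‖x‖ ^ 2 ≤ (r₂ + |a|) ^ 2 := by nlinarith [mul_nonneg hr₂ ha]
  exact (pow_le_pow_iff_left₀ (norm_nonneg x) (by positivity) two_ne_zero).1 h2

/-- The time-normalised shell `{x⁰ = 0, r₁ ≤ r ≤ r₂}` (`r₂ ≥ 0`) is compact. [cite: arXiv07060622, (35)] -/
theorem isCompact_shell (a : ℝ) {r₁ r₂ : ℝ} (hr₂ : 0 ≤ r₂) : IsCompact (shell a r₁ r₂) :=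
  (isCompact_closedBall (0 : E4) (r₂ + |a|)).of_isClosed_subset (isClosed_shell a r₁ r₂)
    fun _ hx => mem_closedBall_zero_iff.2 (norm_le_of_mem_shell hr₂ hx)

/-- The thickened compact shell `K' = B̄(0, r₂ + |a| + 1) ∩ {r ≥ r₁/2}`. [cite: arXiv07060622, (35)] -/
def shell' (a r₁ r₂ : ℝ) : Set E4 :=
  closedBall (0 : E4) (r₂ + |a| + 1) ∩ {x | r₁ / 2 ≤ Kerr.radius a x}

/-- The thickened shell `shell'` is compact. [cite: arXiv07060622, (35)] -/
theorem isCompact_shell' (a r₁ r₂ : ℝ) : IsCompact (shell' a r₁ r₂) :=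
  (isCompact_closedBall (0 : E4) (r₂ + |a| + 1)).inter_right
    (isClosed_le continuous_const (Kerr.continuous_radius a))

/-! #### Operator-norm control of values -/

/-- `A v w ≤ B v w + ‖A − B‖ ‖v‖ ‖w‖`. (operator-norm bookkeeping for the closeness norms of DHRT arXiv:2104.08222, §1) [cite: arXiv210408222] -/
theorem bilin_sub_apply_le (A B : E4 →L[ℝ] E4 →L[ℝ] ℝ) (v w : E4) :
    A v w ≤ B v w + ‖A - B‖ * ‖v‖ * ‖w‖ := by
  have h1 : (A - B) v w ≤ ‖A - B‖ * ‖v‖ * ‖w‖ :=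
    (Real.le_norm_self _).trans ((A - B).le_opNorm₂ v w)
  have h2 : (A - B) v w = A v w - B v w := by
    rfl
  linarith

/-- `B v − ‖A − B‖ ‖v‖ ≤ A v ≤ B v + ‖A − B‖ ‖v‖` for linear forms. (operator-norm bookkeeping for the closeness norms of DHRT arXiv:2104.08222, §1) [cite: arXiv210408222] -/
theorem form_sub_apply_le (A B : E4 →L[ℝ] ℝ) (v : E4) :
    B v - ‖A - B‖ * ‖v‖ ≤ A v ∧ A v ≤ B v + ‖A - B‖ * ‖v‖ := by
  have h1 : (B - A) v ≤ ‖B - A‖ * ‖v‖ := (Real.le_norm_self _).trans ((B - A).le_opNorm v)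
  have h1' : (A - B) v ≤ ‖A - B‖ * ‖v‖ := (Real.le_norm_self _).trans ((A - B).le_opNorm v)
  have h2 : (B - A) v = B v - A v := by rfl
  have h2' : (A - B) v = A v - B v := by rfl
  have h3 : ‖B - A‖ = ‖A - B‖ := norm_sub_rev B A
  rw [h3, h2] at h1
  rw [h2'] at h1'
  constructor <;> linarith

/-! ### §2 Uniform constants and moduli of the Kerr–Schild data on a shell `0 < r₁ ≤ r ≤ r₂` -/

/-- **Bounds.** On `r₁ ≤ r ≤ r₂` (`r₁ > 0`, any `t*`): `‖V‖ ≤ C_V`, `‖dr‖ ≤ C_W` (compactness of the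
time-normalised shell, `t*`-independence). Stationarity of the Kerr–Schild data, Visser arXiv:0706.0622, (32)–(35). [cite: arXiv07060622, (32)–(35)] -/
theorem bound_package (M a : ℝ) {r₁ r₂ : ℝ} (hr₁ : 0 < r₁) (hr₁₂ : r₁ ≤ r₂) :
    ∃ CV CW : ℝ, 1 ≤ CV ∧ 1 ≤ CW ∧
    ∀ p : E4, r₁ ≤ Kerr.radius a p → Kerr.radius a p ≤ r₂ →
      ‖Kerr.timeVector M a p‖ ≤ CV ∧ ‖Kerr.bilin M a p (Kerr.radiusGradVector M a p)‖ ≤ CW := by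
  have hr₂ : 0 ≤ r₂ := hr₁.le.trans hr₁₂
  have hK : IsCompact (shell a r₁ r₂) := isCompact_shell a hr₂
  have hKpos : ∀ x ∈ shell a r₁ r₂, 0 < Kerr.radius a x := fun x hx => lt_of_lt_of_le hr₁ hx.2.1
  obtain ⟨C1, hC1⟩ := hK.exists_bound_of_continuousOn (f := Kerr.timeVector M a)
    (fun x hx => (continuousAt_timeVector M a (hKpos x hx)).continuousWithinAt)
  obtain ⟨C2, hC2⟩ := hK.exists_bound_of_continuousOn
    (f := fun x : E4 => Kerr.bilin M a x (Kerr.radiusGradVector M a x))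
    (fun x hx => (continuousAt_radiusDeriv M a (hKpos x hx)).continuousWithinAt)
  refine ⟨max C1 1, max C2 1, le_max_right _ _, le_max_right _ _, fun p hp1 hp2 => ?_⟩
  have hpK : tn p ∈ shell a r₁ r₂ :=
    ⟨tn_apply_zero p, by rw [radius_tn]; exact hp1, by rw [radius_tn]; exact hp2⟩
  constructor
  · have h := hC1 (tn p) hpK
    rw [timeVector_tn] at h
    exact h.trans (le_max_left _ _)
  · have h := hC2 (tn p) hpK
    simp only [bilin_tn, radiusGradVector_tn] at h
    exact h.trans (le_max_left _ _)

/-- **Moduli.** For `m > 0` there is `ρ ∈ (0, 1]` such that for every `p` with `r₁ ≤ r(p) ≤ r₂` and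
every `q` whose time-normalised point is `ρ`-close to that of `p`: `r(q) > 0`,
`‖g_q − g_p‖ ≤ m`, `‖dr_q − dr_p‖ ≤ m` (Heine–Cantor on the thickened shell). Stationarity of the Kerr–Schild data, Visser arXiv:0706.0622, (32)–(35). [cite: arXiv07060622, (32)–(35)] -/
theorem modulus_package (M a : ℝ) {r₁ r₂ : ℝ} (hr₁ : 0 < r₁) (hr₁₂ : r₁ ≤ r₂) {m : ℝ} (hm : 0 < m) :
    ∃ ρ : ℝ, 0 < ρ ∧ ρ ≤ 1 ∧
    ∀ p : E4, r₁ ≤ Kerr.radius a p → Kerr.radius a p ≤ r₂ →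
    ∀ q : E4, ‖tn q - tn p‖ < ρ →
      0 < Kerr.radius a q ∧ ‖Kerr.bilin M a q - Kerr.bilin M a p‖ ≤ m ∧
      ‖Kerr.bilin M a q (Kerr.radiusGradVector M a q) - Kerr.bilin M a p (Kerr.radiusGradVector M a p)‖ ≤ m := by
  have hr₂ : 0 ≤ r₂ := hr₁.le.trans hr₁₂
  set RK : ℝ := r₂ + |a| with hRK
  have hball : IsCompact (closedBall (0 : E4) (RK + 1)) := isCompact_closedBall _ _
  have hucr : UniformContinuousOn (Kerr.radius a) (closedBall (0 : E4) (RK + 1)) :=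
    hball.uniformContinuousOn_of_continuous (Kerr.continuous_radius a).continuousOn
  obtain ⟨ρ₀, hρ₀, hρ₀'⟩ := Metric.uniformContinuousOn_iff.1 hucr (r₁ / 2) (by positivity)
  have hK' : IsCompact (shell' a r₁ r₂) := isCompact_shell' a r₁ r₂
  have hK'pos : ∀ x ∈ shell' a r₁ r₂, 0 < Kerr.radius a x := by
    intro x hx
    have h2 : r₁ / 2 ≤ Kerr.radius a x := hx.2
    linarith
  have hucG : UniformContinuousOn (Kerr.bilin M a) (shell' a r₁ r₂) :=
    hK'.uniformContinuousOn_of_continuous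
      (fun x hx => (continuousAt_bilin M a (hK'pos x hx)).continuousWithinAt)
  obtain ⟨ρ₁, hρ₁, hρ₁'⟩ := Metric.uniformContinuousOn_iff.1 hucG m hm
  have hucF : UniformContinuousOn (fun x : E4 => Kerr.bilin M a x (Kerr.radiusGradVector M a x))
      (shell' a r₁ r₂) :=
    hK'.uniformContinuousOn_of_continuous
      (fun x hx => (continuousAt_radiusDeriv M a (hK'pos x hx)).continuousWithinAt)
  obtain ⟨ρ₂, hρ₂, hρ₂'⟩ := Metric.uniformContinuousOn_iff.1 hucF m hm
  set ρ : ℝ := min 1 (min ρ₀ (min ρ₁ ρ₂)) with hρ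
  have hρpos : 0 < ρ := lt_min one_pos (lt_min hρ₀ (lt_min hρ₁ hρ₂))
  have hρ1 : ρ ≤ 1 := min_le_left _ _
  have hρρ₀ : ρ ≤ ρ₀ := (min_le_right _ _).trans (min_le_left _ _)
  have hρρ₁ : ρ ≤ ρ₁ := (min_le_right _ _).trans ((min_le_right _ _).trans (min_le_left _ _))
  have hρρ₂ : ρ ≤ ρ₂ := (min_le_right _ _).trans ((min_le_right _ _).trans (min_le_right _ _))
  refine ⟨ρ, hρpos, hρ1, fun p hp1 hp2 q hq => ?_⟩
  have hpK : tn p ∈ shell a r₁ r₂ :=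
    ⟨tn_apply_zero p, by rw [radius_tn]; exact hp1, by rw [radius_tn]; exact hp2⟩
  have hnp : ‖tn p‖ ≤ RK := norm_le_of_mem_shell hr₂ hpK
  have hp_ball : tn p ∈ closedBall (0 : E4) (RK + 1) := mem_closedBall_zero_iff.2 (by linarith)
  have hpK' : tn p ∈ shell' a r₁ r₂ := ⟨hp_ball, by
    show r₁ / 2 ≤ Kerr.radius a (tn p)
    rw [radius_tn]; linarith⟩
  have hq_ball : tn q ∈ closedBall (0 : E4) (RK + 1) := by
    apply mem_closedBall_zero_iff.2
    calc ‖tn q‖ = ‖tn p + (tn q - tn p)‖ := by rw [add_sub_cancel]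
      _ ≤ ‖tn p‖ + ‖tn q - tn p‖ := norm_add_le _ _
      _ ≤ RK + 1 := by linarith
  have hdist : dist (tn q) (tn p) < ρ := by rwa [dist_eq_norm]
  have hr := hρ₀' (tn q) hq_ball (tn p) hp_ball (hdist.trans_le hρρ₀)
  rw [Real.dist_eq, radius_tn, radius_tn] at hr
  have hr' := (abs_lt.1 hr).1
  have hq0 : 0 < Kerr.radius a q := by linarith
  have hqK' : tn q ∈ shell' a r₁ r₂ := ⟨hq_ball, by
    show r₁ / 2 ≤ Kerr.radius a (tn q)
    rw [radius_tn]; linarith⟩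
  refine ⟨hq0, ?_, ?_⟩
  · have hG := hρ₁' (tn q) hqK' (tn p) hpK' (hdist.trans_le hρρ₁)
    rw [dist_eq_norm, bilin_tn, bilin_tn] at hG
    exact hG.le
  · have hF := hρ₂' (tn q) hqK' (tn p) hpK' (hdist.trans_le hρρ₂)
    rw [dist_eq_norm] at hF
    simp only [bilin_tn, radiusGradVector_tn] at hF
    exact hF.le

/-- **Radius along a rest-frame segment** `θ ↦ r(p + θ v)`: derivative `dr_{p+θv}(v)`, hence the two
one-sided mean value bounds. Calculus for the Kerr–Schild radius function, Visser arXiv:0706.0622, (35). [cite: arXiv07060622, (35)] -/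
theorem radius_segment_mvt (M a : ℝ) (p v : E4) {ℓ : ℝ}
    (hpos : ∀ θ ∈ Icc (0 : ℝ) ℓ, 0 < Kerr.radius a (p + θ • v)) {c C : ℝ}
    (hlo : ∀ θ ∈ Icc (0 : ℝ) ℓ, c ≤ Kerr.bilin M a (p + θ • v) (Kerr.radiusGradVector M a (p + θ • v)) v)
    (hhi : ∀ θ ∈ Icc (0 : ℝ) ℓ, Kerr.bilin M a (p + θ • v) (Kerr.radiusGradVector M a (p + θ • v)) v ≤ C) :
    ∀ θ ∈ Icc (0 : ℝ) ℓ, ∀ θ' ∈ Icc (0 : ℝ) ℓ, θ ≤ θ' →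
      c * (θ' - θ) ≤ Kerr.radius a (p + θ' • v) - Kerr.radius a (p + θ • v) ∧
      Kerr.radius a (p + θ' • v) - Kerr.radius a (p + θ • v) ≤ C * (θ' - θ) := by
  have hderiv : ∀ θ ∈ Icc (0 : ℝ) ℓ, HasDerivAt (fun θ : ℝ => Kerr.radius a (p + θ • v))
      (Kerr.bilin M a (p + θ • v) (Kerr.radiusGradVector M a (p + θ • v)) v) θ := by
    intro θ hθ
    have hF := Kerr.hasFDerivAt_radius_bilin (M := M) (hpos θ hθ)
    have hline : HasDerivAt (fun s : ℝ => p + s • v) v θ := by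
      simpa using ((hasDerivAt_id θ).smul_const v).const_add p
    exact hF.comp_hasDerivAt θ hline
  have hcont : ContinuousOn (fun θ : ℝ => Kerr.radius a (p + θ • v)) (Icc 0 ℓ) := by
    have : Continuous fun θ : ℝ => p + θ • v := by fun_prop
    exact ((Kerr.continuous_radius a).comp this).continuousOn
  have hdiff : DifferentiableOn ℝ (fun θ : ℝ => Kerr.radius a (p + θ • v)) (interior (Icc 0 ℓ)) :=
    fun θ hθ => (hderiv θ (interior_subset hθ)).differentiableAt.differentiableWithinAt
  have hge : ∀ θ ∈ interior (Icc (0 : ℝ) ℓ),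
      c ≤ deriv (fun θ : ℝ => Kerr.radius a (p + θ • v)) θ := by
    intro θ hθ
    rw [(hderiv θ (interior_subset hθ)).deriv]
    exact hlo θ (interior_subset hθ)
  have hle : ∀ θ ∈ interior (Icc (0 : ℝ) ℓ),
      deriv (fun θ : ℝ => Kerr.radius a (p + θ • v)) θ ≤ C := by
    intro θ hθ
    rw [(hderiv θ (interior_subset hθ)).deriv]
    exact hhi θ (interior_subset hθ)
  intro θ hθ θ' hθ' hle'
  exact ⟨(convex_Icc (0 : ℝ) ℓ).mul_sub_le_image_sub_of_le_deriv hcont hdiff hge θ hθ θ' hθ' hle',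
    (convex_Icc (0 : ℝ) ℓ).image_sub_le_mul_sub_of_deriv_le hcont hdiff hle θ hθ θ' hθ' hle'⟩

/-- `θ ↦ r(p + θ v)` is continuous. (Visser (35)) [cite: arXiv07060622, (35)] -/
theorem continuousOn_radius_segment (a : ℝ) (p v : E4) (s : Set ℝ) :
    ContinuousOn (fun θ : ℝ => Kerr.radius a (p + θ • v)) s := by
  have : Continuous fun θ : ℝ => p + θ • v := by fun_prop
  exact ((Kerr.continuous_radius a).comp this).continuousOn

/-! #### Smoothness exponents and boost bookkeeping -/

/-- `2 ≤ ∞` in `ℕ∞ω`. [folklore] -/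
private theorem two_le_smooth' : (2 : ℕ∞ω) ≤ ((⊤ : ℕ∞) : WithTop ℕ∞) := WithTop.coe_le_coe.mpr le_top

/-- The boosted Kerr–Schild form on boosted vectors is the Kerr–Schild form in the rest frame:
`g_{Λ,c}(x)(Λv, Λw) = g_{M,a}(Λ⁻¹(x − c))(v, w)`. Kerr–Schild 1965 (Lorentz covariance). [cite: KerrSchild1965] -/
theorem boostedKerrBilin_apply_boost (Λ : lorentzGroup) (c : E4) (M a : ℝ) (x v w : E4) :
    boostedKerrBilin Λ c M a x ((Λ : E4 ≃L[ℝ] E4) v) ((Λ : E4 ≃L[ℝ] E4) w) =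
      Kerr.bilin M a (poincareInv Λ c x) v w := by
  rw [boostedKerrBilin_apply, ContinuousLinearEquiv.symm_apply_apply,
    ContinuousLinearEquiv.symm_apply_apply]

/-- Rest-frame coordinates of a lab segment: `Λ⁻¹(x + θΛv − c) = Λ⁻¹(x − c) + θv`. O'Neill 1983, Ch. 9 (Poincaré maps of `ℝ⁴₁`). [cite: ONeill1983, Ch. 9 pp. 233–236] -/
theorem poincareInv_add_smul (Λ : lorentzGroup) (c x v : E4) (θ : ℝ) :
    poincareInv Λ c (x + θ • (Λ : E4 ≃L[ℝ] E4) v) = poincareInv Λ c x + θ • v := by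
  unfold poincareInv
  rw [show x + θ • (Λ : E4 ≃L[ℝ] E4) v - c = (x - c) + θ • (Λ : E4 ≃L[ℝ] E4) v from by abel,
    map_add, map_smul, ContinuousLinearEquiv.symm_apply_apply]

/-! #### Coercivity of the Kerr–Schild form and operator-norm control of bilinear values -/

/-- `η(v, v) = ‖v‖² − 2 (v⁰)²`. [cite: arXiv07060622, (32)] -/
theorem minkowski_self_eq (v : E4) : Minkowski.bilin v v = ‖v‖ ^ 2 - 2 * v 0 ^ 2 := by
  rw [Minkowski.bilin_apply, norm_sq_E4, Fin.sum_univ_three]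
  simp only [Fin.succ_zero_eq_one, Fin.succ_one_eq_two]
  rw [show (Fin.succ (2 : Fin 3) : Fin 4) = 3 from rfl]
  ring

/-- **Coercivity of the Kerr–Schild form**: `g_{M,a}(p)(v, v) ≥ ‖v‖² − 2 (v⁰)²` for `M ≥ 0`
(`g = η + 2H ℓ ⊗ ℓ` with `H ≥ 0`). Visser arXiv:0706.0622, (32)–(33). [cite: arXiv07060622, (32)–(33)] -/
theorem kerr_self_ge (hM : 0 ≤ M) (p v : E4) : ‖v‖ ^ 2 - 2 * v 0 ^ 2 ≤ Kerr.bilin M a p v v := by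
  rw [Kerr.bilin_apply, minkowski_self_eq]
  nlinarith [Kerr.scalarH_nonneg hM a p, mul_self_nonneg (Kerr.nullCovector a p v)]

/-- `|D X Y| ≤ ‖D‖ ‖X‖ ‖Y‖`. (operator-norm bookkeeping for the closeness norms of DHRT arXiv:2104.08222, §1) [cite: arXiv210408222] -/
theorem abs_apply₂_le (D : E4 →L[ℝ] E4 →L[ℝ] ℝ) (X Y : E4) : |D X Y| ≤ ‖D‖ * ‖X‖ * ‖Y‖ := by
  rw [← Real.norm_eq_abs]; exact D.le_opNorm₂ X Y

/-! ### §3 The chart side: deviation bounds and frozen segments in a time-oriented spacetime -/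

section Chart

variable (𝓢 : Spacetime.{0} 4)

/-- **Metric value of pushed-forward vectors under a deviation bound**:
`g(dΦ v, dΦ w) ≤ g_B(v, w) + ‖Φ^*g − g_B‖ ‖v‖ ‖w‖`. DHRT arXiv:2104.08222, §1. [cite: arXiv210408222] -/
theorem val_mfderiv_le (B : ModelBackground) (Φ : B.domain → 𝓢.carrier)
    (x : B.domain) {ε : ℝ} (hdev : ‖𝓢.deviation B Φ x‖ ≤ ε) (v w : E4) :
    𝓢.metric.val (Φ x) (mfderiv 𝓘(ℝ, E4) (𝓡 4) Φ x v) (mfderiv 𝓘(ℝ, E4) (𝓡 4) Φ x w) ≤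
      B.bilin x.1 v w + ε * ‖v‖ * ‖w‖ := by
  have happ := 𝓢.deviation_apply B Φ x v w
  have h1 : 𝓢.deviation B Φ x v w ≤ ‖𝓢.deviation B Φ x‖ * ‖v‖ * ‖w‖ :=
    (Real.le_norm_self _).trans ((𝓢.deviation B Φ x).le_opNorm₂ v w)
  have h2 : ‖𝓢.deviation B Φ x‖ * ‖v‖ * ‖w‖ ≤ ε * ‖v‖ * ‖w‖ := by gcongr
  linarith

/-- **Variation of the metric value along a chart segment**: at two chart points `x, y`,
`g_y(dΦ u, dΦ u) ≤ g_x(dΦ u, dΦ u) + (g_B(y) − g_B(x))(u, u) + ‖dev(y) − dev(x)‖ ‖u‖²`. DHRT arXiv:2104.08222, §1 (closeness in operator norm). [cite: arXiv210408222] -/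
theorem val_mfderiv_le_of_sub (B : ModelBackground) (Φ : B.domain → 𝓢.carrier)
    (x y : B.domain) {η : ℝ} (hdev : ‖𝓢.deviation B Φ y - 𝓢.deviation B Φ x‖ ≤ η) (u : E4) :
    𝓢.metric.val (Φ y) (mfderiv 𝓘(ℝ, E4) (𝓡 4) Φ y u) (mfderiv 𝓘(ℝ, E4) (𝓡 4) Φ y u) ≤
      𝓢.metric.val (Φ x) (mfderiv 𝓘(ℝ, E4) (𝓡 4) Φ x u) (mfderiv 𝓘(ℝ, E4) (𝓡 4) Φ x u) +
      (B.bilin y.1 u u - B.bilin x.1 u u) + η * ‖u‖ * ‖u‖ := by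
  have hy := 𝓢.deviation_apply B Φ y u u
  have hx := 𝓢.deviation_apply B Φ x u u
  have h1 := bilin_sub_apply_le (𝓢.deviation B Φ y) (𝓢.deviation B Φ x) u u
  have h2 : ‖𝓢.deviation B Φ y - 𝓢.deviation B Φ x‖ * ‖u‖ * ‖u‖ ≤ η * ‖u‖ * ‖u‖ := by gcongr
  linarith

/-- **Transitivity of `≤`** (`J⁺ ∘ J⁺ = J⁺`; O'Neill 1983, Ch. 14, p. 402). [cite: ONeillSemiRiemannian1983, Ch. 14, p. 402] -/
theorem mem_causalFuture_trans' {x y z : 𝓢.carrier}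
    (hxy : y ∈ 𝓢.metric.causalFuture 𝓢.timeOrientation {x})
    (hyz : z ∈ 𝓢.metric.causalFuture 𝓢.timeOrientation {y}) :
    z ∈ 𝓢.metric.causalFuture 𝓢.timeOrientation {x} := by
  have h1 : z ∈ 𝓢.metric.causalFuture 𝓢.timeOrientation
      (𝓢.metric.causalFuture 𝓢.timeOrientation {x}) :=
    LorentzianMetric.causalFuture_mono (Set.singleton_subset_iff.2 hxy) hyz
  rwa [LorentzianMetric.causalFuture_causalFuture_eq two_le_smooth'] at h1

/-- **Pointwise `C⁰` and `C¹` bounds from the `C¹` slab bound**: if the `C¹` sup norm of the extended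
deviation on every late truncated slab `{t* = τ, r ≤ R}`, `τ ≥ τ₁`, is `≤ ε`, then at every late chart
point with `r ≤ R`: `‖dev‖ ≤ ε` and `‖D dev‖ ≤ ε`. Bartnik, CPAM 39 (1986), (1.3). [cite: Bartnik1986, (1.3)] -/
theorem dev_bounds (B : ModelBackground) (Φ : B.domain → 𝓢.carrier) {R τ₁ ε : ℝ} (hε : 0 ≤ ε)
    (hdev : ∀ τ : ℝ, τ₁ ≤ τ → 𝓢.truncDeviationCk B Φ 1 R τ ≤ ENNReal.ofReal ε)
    (x : B.domain) (hx0 : τ₁ ≤ B.time x.1) (hx1 : B.radius x.1 ≤ R) :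
    ‖𝓢.deviation B Φ x‖ ≤ ε ∧ ‖fderiv ℝ (𝓢.deviationExtend B Φ) x.1‖ ≤ ε := by
  have hxS : x ∈ B.truncTimeSlab R (B.time x.1) := ⟨rfl, hx1⟩
  have h : supCkENorm (Subtype.val '' B.truncTimeSlab R (B.time x.1)) 1 (𝓢.deviationExtend B Φ) ≤
      ENNReal.ofReal ε := hdev (B.time x.1) hx0
  refine ⟨BoostedKerrLegs.norm_deviation_le_of_supCkENorm_le 𝓢 B Φ hε h x hxS, ?_⟩
  have hmem : x.1 ∈ Subtype.val '' B.truncTimeSlab R (B.time x.1) := mem_image_of_mem _ hxS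
  have h1 := enorm_iteratedFDeriv_le_supCkENorm (le_refl 1) hmem (𝓢.deviationExtend B Φ)
  have h2 : ‖iteratedFDeriv ℝ 1 (𝓢.deviationExtend B Φ) x.1‖ₑ ≤ ENNReal.ofReal ε := h1.trans h
  rw [← ofReal_norm, ENNReal.ofReal_le_ofReal_iff hε] at h2
  refine ContinuousLinearMap.opNorm_le_bound _ hε fun v => ?_
  have h3 := (iteratedFDeriv ℝ 1 (𝓢.deviationExtend B Φ) x.1).le_opNorm (fun _ => v)
  rw [iteratedFDeriv_one_apply, Fin.prod_univ_one] at h3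
  exact h3.trans (mul_le_mul_of_nonneg_right h2 (norm_nonneg _))

/-- **The deviation is `ε`-Lipschitz along chart segments** on which `‖D dev‖ ≤ ε` and the background
form is smooth (mean value inequality for `θ ↦ dev(p + θu)`). DHRT arXiv:2104.08222, §1 (the `C¹` closeness norm controls the variation of `g − g_{a,M}`). [cite: arXiv210408222] -/
theorem deviation_segment_lipschitz (B : ModelBackground) (Φ : B.domain → 𝓢.carrier)
    (hΦ : ContMDiff 𝓘(ℝ, E4) (𝓡 4) ((⊤ : ℕ∞) : WithTop ℕ∞) Φ) (p u : E4) {ℓ ε : ℝ}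
    (hdom : ∀ θ ∈ Icc (0 : ℝ) ℓ, p + θ • u ∈ (B.domain : Set E4))
    (hsm : ∀ θ ∈ Icc (0 : ℝ) ℓ, ContDiffAt ℝ ((⊤ : ℕ∞) : WithTop ℕ∞) B.bilin (p + θ • u))
    (hD : ∀ θ ∈ Icc (0 : ℝ) ℓ, ‖fderiv ℝ (𝓢.deviationExtend B Φ) (p + θ • u)‖ ≤ ε) :
    ∀ θ ∈ Icc (0 : ℝ) ℓ,
      ‖𝓢.deviationExtend B Φ (p + θ • u) - 𝓢.deviationExtend B Φ p‖ ≤ ε * ‖u‖ * θ := by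
  have hderiv : ∀ θ ∈ Icc (0 : ℝ) ℓ,
      HasDerivWithinAt (fun θ : ℝ => 𝓢.deviationExtend B Φ (p + θ • u))
        (fderiv ℝ (𝓢.deviationExtend B Φ) (p + θ • u) u) (Icc 0 ℓ) θ := by
    intro θ hθ
    have hdiff : DifferentiableAt ℝ (𝓢.deviationExtend B Φ) (p + θ • u) :=
      (𝓢.contDiffAt_deviationExtend_model B hΦ ⟨p + θ • u, hdom θ hθ⟩ (hsm θ hθ)).differentiableAt
        (by simp)
    have hline : HasDerivAt (fun s : ℝ => p + s • u) u θ := by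
      simpa using ((hasDerivAt_id θ).smul_const u).const_add p
    exact (hdiff.hasFDerivAt.comp_hasDerivAt θ hline).hasDerivWithinAt
  have hbound : ∀ θ ∈ Ico (0 : ℝ) ℓ, ‖fderiv ℝ (𝓢.deviationExtend B Φ) (p + θ • u) u‖ ≤ ε * ‖u‖ :=
    fun θ hθ => ((fderiv ℝ (𝓢.deviationExtend B Φ) (p + θ • u)).le_opNorm u).trans
      (mul_le_mul_of_nonneg_right (hD θ (Ico_subset_Icc_self hθ)) (norm_nonneg u))
  intro θ hθ
  have h := norm_image_sub_le_of_norm_deriv_le_segment' hderiv hbound θ hθ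
  simp only [zero_smul, add_zero, sub_zero] at h
  exact h

end Chart

end KerrPeel

end Literature.Geometry.Lorentzian
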